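import Summits.QuantumFields.YangMills.Theorems.UnitScaleTiltProp7LatticeCutoffOneForm
import Summits.QuantumFields.YangMills.Theorems.UnitScaleTiltProp7LatticeBoxPotentialAlgebra
import HarnessLib

/-!
# Route `UnitScaleTilt`, crux K1 «MinimiserStabilityRegPr» (stmt-QuantumFields-19200), LANE II «DIVERGENCE RECOVERY AT CURVED `W`» (★★OWNER RULING №23),
# brick [I-7] `h10`, `ℤᵈ` half: THE `H¹` ROW OF A CUTOFF ONE-FORM SHARPENED BY THE SUPPORT OF THE CUTOFF, AND THE CURL OF THE TRANSVERSE REMAINDER ON THE INTERIOR BOX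

Cell `ym3-torus` (HUMAN RULING D-0037: YM₃ on T³ is ladder rung R3 — NOT d = 4, NOT infinite volume, NOT a mass gap, NOT the Clay problem), width seat
`ym-ust-20520-w5` (gen 11), pen of [I-7] `h10` (★p1 g19 NAMER WORD №13; px12 g7 ■ hand-over, split w4-19200 g11 ↔ `h4`, this seat ↔ `h10`).  THEOREMS ONLY
(0 `def`, 0 `sorry`); `--supports stmt-QuantumFields-19200 --as helper`, count-neutral.  Nothing here claims (REC), `hN06`, a stub, the crux or the gap.

THE POINT.  px4 g7's (B1″) ✓`Prop7LatticeCutoffOneForm.cutoff_curl_div_le` bounds the `H¹` energy of `h := ζ·g` on a box `Q_R(z)` by `3·CURL_in(g) + 2·DIV_box(g)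
+ 8dδ²Σ‖g‖²` with the FULL-box divergence of `g`.  For the transverse remainder `g = 1_{inside}·(y − ∇_Vφ)` of the box patch's Coulomb potential ((B8)) the divergence
is the axial-constant source `R(u)⁻¹m` — but the member package (B8-member) exports that identity on the INTERIOR `Q_{R−1}(z)` only (its (L1) row), the boundary
layer of the chart being where the member's `D*_W y` reads bonds outside the chart.  §1 therefore re-reads the product rules of (B1″) (✓`cutoff_curl_eq`,
✓`cutoff_div_eq`, used BY NAME) keeping the information `ζ(y) = 0` off `Q_{R−1}(z)`: the `ζ(y)²`-weighted curl and divergence of `g` are charged over `Q_{R−1}(z)`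
only.  §2 prices the curl of `g` on `Q_{R−1}(z)` by the curl of `y` plus the plaquette commutator on `φ` (✓`Prop7LatticeBoxPotentialAlgebra.norm_covCurl_grad_le_of_plaqSmall`),
and §3 is the scalar bookkeeping of the member reading (sibling file `UnitScaleTiltProp7BoxLocalPotentialCutoffH1`, theorem `cutoffH1_member`).
* §1 `cutoff_curl_div_le_supp` — `Σ_{Q_R}ΣΣ‖curl_V(ζg)‖² + Σ_{Q_R}‖div_V(ζg)‖² ≤ 3·Σ_{Q_{R−1}}ΣΣ‖curl_V g‖² + 2·Σ_{Q_{R−1}}‖div_V g‖² + 8d·δ²·Σ_{Q_R}Σ‖g‖²`.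
* §2 `sum_normSq_curl_defect_le` — `Σ_{Q_{R−1}}ΣΣ‖curl_V g‖² ≤ 2·Σ_{Q_{R−1}}ΣΣ‖curl_V y‖² + 8α²d²·Σ_{Q_R}‖φ‖²` for `g = y − ∇_Vφ` on the inside bonds, `PlaqSmall V α`.
* §3 `sum_sum_eq_two_mul_sum_lt` (pairs ↔ plaquettes), `frob_real_smul`, `h10_arith` (the four channels with `ηℓ = 1`).
HONEST SCOPE.  Finite sums and the triangle inequality over landed bricks; no YM content; rung R3, not d = 4, not Clay; the YM mass gap is NOT proved.

References: T. Bałaban, CMP 99 (1985) 389–434 [Balaban1985BackgroundPropagators] ((3.10) p.392, (3.23) p.394); CMP 98 (1985) 17–51 [Balaban1985Averaging] (pp.24–25);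
M. Giaquinta, *Multiple integrals in the calculus of variations and nonlinear elliptic systems* (1983) [Giaquinta1984] (Ch. III §1).
-/

set_option autoImplicit false

noncomputable section

open scoped BigOperators Matrix.Norms.L2Operator
open Finset

namespace Summit.QuantumFields.YangMills.Theorems.Prop7LatticeCutoffOneFormSupp

open Literature.MathematicalPhysics.QuantumFieldTheory.Balaban1983to89
open Literature.MathematicalPhysics.QuantumFieldTheory.Balaban1983to89.B4Eq19LatticeOperators (Zd box mem_box unitVec box_mono add_unitVec_mem_box
  sub_unitVec_mem_box)
open B7Eq78Linearization (conjR conjR_apply conjR_sub conjR_smul)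
open B7Prop1Explicit (U1)
open B8Ineq132 (norm_conjR)
open Summit.QuantumFields.YangMills.Theorems.Prop7LatticeBoxFriedrichsCov (sum_box_shift_le)
open Summit.QuantumFields.YangMills.Theorems.Prop7LatticeCutoffOneForm (cutoff_curl_eq cutoff_div_eq norm_sq_smul_three_le norm_sq_smul_add_sum_le)
open Summit.QuantumFields.YangMills.Theorems.Prop7LatticeBoxPotentialAlgebra (norm_covCurl_grad_le_of_plaqSmall)

/-! ## §1 The H¹ row of a cutoff one-form, sharpened by the support of the cutoff -/

section Zd

variable {d N : ℕ}

/-- `Σ_{y ∈ Q_R} [y ∈ Q_{R−1}]·f y = Σ_{y ∈ Q_{R−1}} f y` (the interior box is contained in the box). [folklore] -/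
theorem sum_box_ite_mem_inner (z : Zd d) (R : ℤ) (f : Zd d → ℝ) :
    ∑ y ∈ box z R, (if y ∈ box z (R - 1) then f y else 0) = ∑ y ∈ box z (R - 1), f y := by
  rw [Finset.sum_ite_mem, Finset.inter_eq_right.mpr (box_mono z (by linarith))]

/-- ★ **(B1″) SHARPENED BY THE SUPPORT** — `V ∈ U1`, `|ζ| ≤ 1`, `|ζ(y+e_μ) − ζ y| ≤ δ`, `supp ζ ⊆ Q_{R−1}(z)`, `g` on the edges of `Q_R(z)`, `h := ζ·g`:
`Σ_{Q_R}Σ_μΣ_ν‖curl_V h‖² + Σ_{Q_R}‖div_V h‖² ≤ 3·Σ_{Q_{R−1}}Σ_μΣ_ν‖curl_V g‖² + 2·Σ_{Q_{R−1}}‖div_V g‖² + 8d·δ²·Σ_{Q_R}Σ_μ‖g‖²` — the `ζ(y)²`-weighted terms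
of the product rules (✓`cutoff_curl_eq`, ✓`cutoff_div_eq`) are charged only where `ζ(y) ≠ 0`, i.e. over `Q_{R−1}(z)`; the oscillation terms are px4's.
[cite: Balaban1985BackgroundPropagators, (3.10) p.392; Giaquinta1984, Ch. III §1] -/
theorem cutoff_curl_div_le_supp [NeZero N] {z : Zd d} {R : ℤ} {δ : ℝ}
    (V : Zd d → Fin d → (Matrix (Fin N) (Fin N) ℂ)ˣ) (hV : ∀ y μ, V y μ ∈ U1 (Matrix (Fin N) (Fin N) ℂ))
    (ζ : Zd d → ℝ) (hζ1 : ∀ y, |ζ y| ≤ 1) (hζδ : ∀ (y : Zd d) (μ : Fin d), |ζ (y + unitVec μ) - ζ y| ≤ δ)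
    (hζs : ∀ y ∉ box z (R - 1), ζ y = 0)
    (g : Zd d → Fin d → Matrix (Fin N) (Fin N) ℂ) (hg : ∀ (y : Zd d) (μ : Fin d), (y ∉ box z R ∨ y + unitVec μ ∉ box z R) → g y μ = 0) :
    ∑ y ∈ box z R, ∑ μ, ∑ ν,
        ‖((ζ y : ℂ) • g y μ) + conjR (V y μ) (((ζ (y + unitVec μ) : ℝ) : ℂ) • g (y + unitVec μ) ν)
          - conjR (V y ν) (((ζ (y + unitVec ν) : ℝ) : ℂ) • g (y + unitVec ν) μ) - ((ζ y : ℂ) • g y ν)‖ ^ 2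
      + ∑ y ∈ box z R, ‖∑ μ, (conjR (V (y - unitVec μ) μ)⁻¹ (((ζ (y - unitVec μ) : ℝ) : ℂ) • g (y - unitVec μ) μ) - (ζ y : ℂ) • g y μ)‖ ^ 2
      ≤ 3 * ∑ y ∈ box z (R - 1), ∑ μ, ∑ ν, ‖g y μ + conjR (V y μ) (g (y + unitVec μ) ν) - conjR (V y ν) (g (y + unitVec ν) μ) - g y ν‖ ^ 2
        + 2 * ∑ y ∈ box z (R - 1), ‖∑ μ, (conjR (V (y - unitVec μ) μ)⁻¹ (g (y - unitVec μ) μ) - g y μ)‖ ^ 2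
        + 8 * d * δ ^ 2 * ∑ y ∈ box z R, ∑ μ, ‖g y μ‖ ^ 2 := by
  -- `ζ(y)² ≤ [y ∈ Q_{R−1}]`
  have hζind : ∀ (y : Zd d) (t : ℝ), 0 ≤ t → ζ y ^ 2 * t ≤ (if y ∈ box z (R - 1) then t else 0) := by
    intro y t ht
    by_cases hy : y ∈ box z (R - 1)
    · rw [if_pos hy]
      have h1 : ζ y ^ 2 ≤ 1 := by
        have := hζ1 y; rw [← sq_abs]; nlinarith [abs_nonneg (ζ y)]
      nlinarith
    · rw [if_neg hy, hζs y hy]; simp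
  -- ### the curl part, pointwise
  have hcurl : ∀ (y : Zd d) (μ ν : Fin d),
      ‖((ζ y : ℂ) • g y μ) + conjR (V y μ) (((ζ (y + unitVec μ) : ℝ) : ℂ) • g (y + unitVec μ) ν)
          - conjR (V y ν) (((ζ (y + unitVec ν) : ℝ) : ℂ) • g (y + unitVec ν) μ) - ((ζ y : ℂ) • g y ν)‖ ^ 2
        ≤ 3 * (if y ∈ box z (R - 1) then ‖g y μ + conjR (V y μ) (g (y + unitVec μ) ν) - conjR (V y ν) (g (y + unitVec ν) μ) - g y ν‖ ^ 2 else 0)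
          + 3 * δ ^ 2 * ‖g (y + unitVec μ) ν‖ ^ 2 + 3 * δ ^ 2 * ‖g (y + unitVec ν) μ‖ ^ 2 := by
    intro y μ ν
    rw [cutoff_curl_eq]
    refine (norm_sq_smul_three_le _ _ _ _ _ _).trans ?_
    rw [norm_conjR (hV y μ), norm_conjR (hV y ν)]
    have hb : (ζ (y + unitVec μ) - ζ y) ^ 2 ≤ δ ^ 2 := by
      rw [← sq_abs]; exact pow_le_pow_left₀ (abs_nonneg _) (hζδ y μ) 2
    have hc : (ζ (y + unitVec ν) - ζ y) ^ 2 ≤ δ ^ 2 := by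
      rw [← sq_abs]; exact pow_le_pow_left₀ (abs_nonneg _) (hζδ y ν) 2
    have ha := hζind y (‖g y μ + conjR (V y μ) (g (y + unitVec μ) ν) - conjR (V y ν) (g (y + unitVec ν) μ) - g y ν‖ ^ 2) (by positivity)
    have hB0 : 0 ≤ ‖g (y + unitVec μ) ν‖ ^ 2 := by positivity
    have hC0 : 0 ≤ ‖g (y + unitVec ν) μ‖ ^ 2 := by positivity
    nlinarith [mul_le_mul_of_nonneg_right hb hB0, mul_le_mul_of_nonneg_right hc hC0]
  -- ### the divergence part, pointwise
  have hdiv : ∀ y : Zd d,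
      ‖∑ μ, (conjR (V (y - unitVec μ) μ)⁻¹ (((ζ (y - unitVec μ) : ℝ) : ℂ) • g (y - unitVec μ) μ) - (ζ y : ℂ) • g y μ)‖ ^ 2
        ≤ 2 * (if y ∈ box z (R - 1) then ‖∑ μ, (conjR (V (y - unitVec μ) μ)⁻¹ (g (y - unitVec μ) μ) - g y μ)‖ ^ 2 else 0)
          + 2 * d * δ ^ 2 * ∑ μ, ‖g (y - unitVec μ) μ‖ ^ 2 := by
    intro y
    rw [cutoff_div_eq]
    refine (norm_sq_smul_add_sum_le _ _ _ _).trans ?_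
    have ha := hζind y (‖∑ μ, (conjR (V (y - unitVec μ) μ)⁻¹ (g (y - unitVec μ) μ) - g y μ)‖ ^ 2) (by positivity)
    have h2 : ∑ μ, (ζ (y - unitVec μ) - ζ y) ^ 2 * ‖conjR (V (y - unitVec μ) μ)⁻¹ (g (y - unitVec μ) μ)‖ ^ 2
        ≤ δ ^ 2 * ∑ μ, ‖g (y - unitVec μ) μ‖ ^ 2 := by
      rw [Finset.mul_sum]
      refine Finset.sum_le_sum fun μ _ => ?_
      rw [norm_conjR ((U1 _).inv_mem (hV _ _))]
      have hb : (ζ (y - unitVec μ) - ζ y) ^ 2 ≤ δ ^ 2 := by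
        rw [← sq_abs, abs_sub_comm]
        have := hζδ (y - unitVec μ) μ
        rw [sub_add_cancel] at this
        exact pow_le_pow_left₀ (abs_nonneg _) this 2
      exact mul_le_mul_of_nonneg_right hb (by positivity)
    have hd : (0 : ℝ) ≤ d := Nat.cast_nonneg _
    nlinarith [mul_le_mul_of_nonneg_left h2 (by positivity : (0 : ℝ) ≤ 2 * d)]
  -- ### summation and the shifts
  have hG0 : ∀ y, 0 ≤ ∑ ν, ‖g y ν‖ ^ 2 := fun y => Finset.sum_nonneg fun ν _ => by positivity
  have hGs : ∀ y ∉ box z R, ∑ ν, ‖g y ν‖ ^ 2 = 0 := by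
    intro y hy; exact Finset.sum_eq_zero fun ν _ => by rw [hg y ν (Or.inl hy), norm_zero]; simp
  have hshift1 : ∑ y ∈ box z R, ∑ μ, ∑ ν, ‖g (y + unitVec μ) ν‖ ^ 2 ≤ d * ∑ y ∈ box z R, ∑ μ, ‖g y μ‖ ^ 2 := by
    rw [Finset.sum_comm]
    calc ∑ μ, ∑ y ∈ box z R, ∑ ν, ‖g (y + unitVec μ) ν‖ ^ 2 ≤ ∑ μ : Fin d, ∑ y ∈ box z R, ∑ ν, ‖g y ν‖ ^ 2 :=
          Finset.sum_le_sum fun μ _ => sum_box_shift_le (H := fun y => ∑ ν, ‖g y ν‖ ^ 2) hG0 hGs (unitVec μ)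
      _ = d * ∑ y ∈ box z R, ∑ μ, ‖g y μ‖ ^ 2 := by rw [Finset.sum_const, Finset.card_univ, Fintype.card_fin, nsmul_eq_mul]
  have hshift2 : ∑ y ∈ box z R, ∑ μ, ∑ ν, ‖g (y + unitVec ν) μ‖ ^ 2 ≤ d * ∑ y ∈ box z R, ∑ μ, ‖g y μ‖ ^ 2 := by
    have e : ∑ y ∈ box z R, ∑ μ, ∑ ν, ‖g (y + unitVec ν) μ‖ ^ 2 = ∑ y ∈ box z R, ∑ μ, ∑ ν, ‖g (y + unitVec μ) ν‖ ^ 2 :=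
      Finset.sum_congr rfl fun y _ => Finset.sum_comm
    rw [e]; exact hshift1
  have hGμ0 : ∀ (μ : Fin d) (y : Zd d), 0 ≤ ‖g y μ‖ ^ 2 := fun μ y => by positivity
  have hGμs : ∀ (μ : Fin d), ∀ y ∉ box z R, ‖g y μ‖ ^ 2 = 0 := by
    intro μ y hy; rw [hg y μ (Or.inl hy), norm_zero]; simp
  have hshift3 : ∑ y ∈ box z R, ∑ μ, ‖g (y - unitVec μ) μ‖ ^ 2 ≤ ∑ y ∈ box z R, ∑ μ, ‖g y μ‖ ^ 2 := by
    rw [Finset.sum_comm, Finset.sum_comm (s := box z R)]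
    refine Finset.sum_le_sum fun μ _ => ?_
    have h := sum_box_shift_le (z := z) (R := R) (H := fun y => ‖g y μ‖ ^ 2) (hGμ0 μ) (hGμs μ) (-unitVec μ)
    simpa [sub_eq_add_neg] using h
  -- the `ζ²`-weighted parts land on the interior box
  have hcurlI : ∑ y ∈ box z R, ∑ μ, ∑ ν,
      (if y ∈ box z (R - 1) then ‖g y μ + conjR (V y μ) (g (y + unitVec μ) ν) - conjR (V y ν) (g (y + unitVec ν) μ) - g y ν‖ ^ 2 else (0 : ℝ))
      = ∑ y ∈ box z (R - 1), ∑ μ, ∑ ν, ‖g y μ + conjR (V y μ) (g (y + unitVec μ) ν) - conjR (V y ν) (g (y + unitVec ν) μ) - g y ν‖ ^ 2 := by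
    rw [← sum_box_ite_mem_inner z R]
    refine Finset.sum_congr rfl fun y _ => ?_
    split_ifs <;> simp
  have hdivI : ∑ y ∈ box z R, (if y ∈ box z (R - 1) then ‖∑ μ, (conjR (V (y - unitVec μ) μ)⁻¹ (g (y - unitVec μ) μ) - g y μ)‖ ^ 2 else (0 : ℝ))
      = ∑ y ∈ box z (R - 1), ‖∑ μ, (conjR (V (y - unitVec μ) μ)⁻¹ (g (y - unitVec μ) μ) - g y μ)‖ ^ 2 :=
    sum_box_ite_mem_inner z R _
  -- assemble
  have hsumC := Finset.sum_le_sum fun y (_ : y ∈ box z R) => Finset.sum_le_sum fun μ (_ : μ ∈ Finset.univ) =>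
    Finset.sum_le_sum fun ν (_ : ν ∈ Finset.univ) => hcurl y μ ν
  have hsumD := Finset.sum_le_sum fun y (_ : y ∈ box z R) => hdiv y
  refine (add_le_add hsumC hsumD).trans ?_
  simp only [Finset.sum_add_distrib, ← Finset.mul_sum]
  rw [hcurlI, hdivI]
  have hd : (0 : ℝ) ≤ d := Nat.cast_nonneg _
  have hδ2 : 0 ≤ δ ^ 2 := by positivity
  nlinarith [mul_le_mul_of_nonneg_left hshift1 hδ2, mul_le_mul_of_nonneg_left hshift2 hδ2,
    mul_le_mul_of_nonneg_left hshift3 (by positivity : (0 : ℝ) ≤ 2 * d * δ ^ 2)]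

/-! ## §2 (`ℤᵈ`) The curl of the inside-restricted transverse remainder on the interior box -/

/-- `Σ_{y ∈ Q_{R−1}} ‖φ(y + e_μ + e_ν)‖² ≤ Σ_{w ∈ Q_R} ‖φ w‖²` for `μ ≠ ν` (an injective shift of the interior box into the box). [folklore] -/
theorem sum_inner_shift_two_le {z : Zd d} {R : ℤ} (φ : Zd d → Matrix (Fin N) (Fin N) ℂ) {μ ν : Fin d} (hμν : μ ≠ ν) :
    ∑ y ∈ box z (R - 1), ‖φ (y + unitVec μ + unitVec ν)‖ ^ 2 ≤ ∑ w ∈ box z R, ‖φ w‖ ^ 2 := by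
  classical
  set H : Zd d → ℝ := fun w => if w ∈ box z R then ‖φ w‖ ^ 2 else 0 with hH
  have hH0 : ∀ w, 0 ≤ H w := fun w => by simp only [hH]; split_ifs <;> positivity
  have hHs : ∀ w ∉ box z R, H w = 0 := fun w hw => by simp only [hH, if_neg hw]
  calc ∑ y ∈ box z (R - 1), ‖φ (y + unitVec μ + unitVec ν)‖ ^ 2
      = ∑ y ∈ box z (R - 1), H (y + (unitVec μ + unitVec ν)) := by
        refine Finset.sum_congr rfl fun y hy => ?_
        rw [hH]; dsimp only
        rw [← add_assoc, if_pos (Prop7LatticeCutoffOneForm.add_two_unitVec_mem_box hy hμν)]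
    _ ≤ ∑ y ∈ box z R, H (y + (unitVec μ + unitVec ν)) :=
        Finset.sum_le_sum_of_subset_of_nonneg (box_mono z (by linarith)) fun y _ _ => hH0 _
    _ ≤ ∑ y ∈ box z R, H y := sum_box_shift_le hH0 hHs _
    _ = ∑ w ∈ box z R, ‖φ w‖ ^ 2 := Finset.sum_congr rfl fun w hw => by rw [hH]; dsimp only; rw [if_pos hw]

/-- ★ **THE CURL OF THE TRANSVERSE REMAINDER ON THE INTERIOR BOX**: `V ∈ U1` with `PlaqSmall V (z−R) (z+R) α`; `g = Y − ∇_Vφ` on the inside bonds of `Q_R(z)`.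
Then on `Q_{R−1}(z)` (where all four bonds of a plaquette are inside) `curl_V g = curl_V Y − [curl_V ∇_V]φ` and the commutator is the plaquette defect,
`‖[curl_V∇_V]φ (y,μ,ν)‖ ≤ 2α‖φ(y+e_μ+e_ν)‖` (✓`norm_covCurl_grad_le_of_plaqSmall`):
`Σ_{Q_{R−1}}Σ_μΣ_ν‖curl_V g‖² ≤ 2·Σ_{Q_{R−1}}Σ_μΣ_ν‖curl_V Y‖² + 8α²d²·Σ_{Q_R}‖φ‖²`. [cite: Balaban1985BackgroundPropagators, (3.10) p.392; Balaban1985Averaging, pp.24-25] -/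
theorem sum_normSq_curl_defect_le [NeZero N] {z : Zd d} {R : ℤ} {α : ℝ} (hα : 0 ≤ α)
    (V : Zd d → Fin d → (Matrix (Fin N) (Fin N) ℂ)ˣ) (hV : ∀ y μ, V y μ ∈ U1 (Matrix (Fin N) (Fin N) ℂ))
    (hP : B8Lemma1NonAbelian.PlaqSmall V (fun i => z i - R) (fun i => z i + R) α)
    (Y g : Zd d → Fin d → Matrix (Fin N) (Fin N) ℂ) (φ : Zd d → Matrix (Fin N) (Fin N) ℂ)
    (hgin : ∀ w ∈ box z R, ∀ μ : Fin d, w + unitVec μ ∈ box z R → g w μ = Y w μ - (conjR (V w μ) (φ (w + unitVec μ)) - φ w)) :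
    ∑ y ∈ box z (R - 1), ∑ μ, ∑ ν, ‖g y μ + conjR (V y μ) (g (y + unitVec μ) ν) - conjR (V y ν) (g (y + unitVec ν) μ) - g y ν‖ ^ 2
      ≤ 2 * ∑ y ∈ box z (R - 1), ∑ μ, ∑ ν, ‖Y y μ + conjR (V y μ) (Y (y + unitVec μ) ν) - conjR (V y ν) (Y (y + unitVec ν) μ) - Y y ν‖ ^ 2
        + 8 * α ^ 2 * d ^ 2 * ∑ w ∈ box z R, ‖φ w‖ ^ 2 := by
  classical
  -- pointwise on the interior box
  have hpt : ∀ y ∈ box z (R - 1), ∀ μ ν : Fin d,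
      ‖g y μ + conjR (V y μ) (g (y + unitVec μ) ν) - conjR (V y ν) (g (y + unitVec ν) μ) - g y ν‖ ^ 2
        ≤ 2 * ‖Y y μ + conjR (V y μ) (Y (y + unitVec μ) ν) - conjR (V y ν) (Y (y + unitVec ν) μ) - Y y ν‖ ^ 2
          + 8 * α ^ 2 * (if μ ≠ ν then ‖φ (y + unitVec μ + unitVec ν)‖ ^ 2 else 0) := by
    intro y hy μ ν
    by_cases hμν : μ = ν
    · subst hμν
      have h0 : g y μ + conjR (V y μ) (g (y + unitVec μ) μ) - conjR (V y μ) (g (y + unitVec μ) μ) - g y μ = 0 := by abel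
      rw [h0, norm_zero, if_neg (not_not.mpr rfl), mul_zero, add_zero, zero_pow two_ne_zero]
      positivity
    · rw [if_pos hμν]
      have hyR : y ∈ box z R := box_mono z (by linarith) hy
      have hμν' := Prop7LatticeCutoffOneForm.add_two_unitVec_mem_box hy hμν
      have hνμ' : y + unitVec ν + unitVec μ ∈ box z R := by rw [add_right_comm]; exact hμν'
      have hyμ : y + unitVec μ ∈ box z R := by
        have := add_unitVec_mem_box hy μ; rwa [sub_add_cancel] at this
      have hyν : y + unitVec ν ∈ box z R := by
        have := add_unitVec_mem_box hy ν; rwa [sub_add_cancel] at this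
      rw [hgin y hyR μ hyμ, hgin (y + unitVec μ) hyμ ν hμν', hgin (y + unitVec ν) hyν μ hνμ', hgin y hyR ν hyν]
      set E := (conjR (V y μ) (φ (y + unitVec μ)) - φ y)
          + conjR (V y μ) (conjR (V (y + unitVec μ) ν) (φ (y + unitVec μ + unitVec ν)) - φ (y + unitVec μ))
          - conjR (V y ν) (conjR (V (y + unitVec ν) μ) (φ (y + unitVec ν + unitVec μ)) - φ (y + unitVec ν))
          - (conjR (V y ν) (φ (y + unitVec ν)) - φ y) with hE
      set C := Y y μ + conjR (V y μ) (Y (y + unitVec μ) ν) - conjR (V y ν) (Y (y + unitVec ν) μ) - Y y ν with hC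
      have halg : Y y μ - (conjR (V y μ) (φ (y + unitVec μ)) - φ y)
            + conjR (V y μ) (Y (y + unitVec μ) ν - (conjR (V (y + unitVec μ) ν) (φ (y + unitVec μ + unitVec ν)) - φ (y + unitVec μ)))
            - conjR (V y ν) (Y (y + unitVec ν) μ - (conjR (V (y + unitVec ν) μ) (φ (y + unitVec ν + unitVec μ)) - φ (y + unitVec ν)))
            - (Y y ν - (conjR (V y ν) (φ (y + unitVec ν)) - φ y)) = C - E := by
        rw [hC, hE]; simp only [conjR_sub]; abel
      rw [halg]
      have hEle : ‖E‖ ≤ 2 * α * ‖φ (y + unitVec μ + unitVec ν)‖ := by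
        rw [hE]; exact norm_covCurl_grad_le_of_plaqSmall hα V hV hP φ y μ ν hyR hμν'
      have h1 : ‖C - E‖ ≤ ‖C‖ + ‖E‖ := norm_sub_le _ _
      have h2 := pow_le_pow_left₀ (norm_nonneg _) h1 2
      have hE0 : 0 ≤ ‖E‖ := norm_nonneg _
      have hC0 : 0 ≤ ‖C‖ := norm_nonneg _
      nlinarith [sq_nonneg (‖C‖ - ‖E‖), pow_le_pow_left₀ hE0 hEle 2, sq_nonneg α, norm_nonneg (φ (y + unitVec μ + unitVec ν))]
  -- the shifted masses land in the box
  have hshift : ∀ μ ν : Fin d, ∑ y ∈ box z (R - 1), (if μ ≠ ν then ‖φ (y + unitVec μ + unitVec ν)‖ ^ 2 else (0 : ℝ))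
      ≤ ∑ w ∈ box z R, ‖φ w‖ ^ 2 := by
    intro μ ν
    by_cases hμν : μ = ν
    · simp only [ne_eq, hμν, not_true_eq_false, if_false, Finset.sum_const_zero]
      exact Finset.sum_nonneg fun w _ => by positivity
    · simp only [ne_eq, hμν, not_false_eq_true, if_true]
      exact sum_inner_shift_two_le φ hμν
  -- assemble
  have hsum := Finset.sum_le_sum fun y hy => Finset.sum_le_sum fun μ (_ : μ ∈ Finset.univ) =>
    Finset.sum_le_sum fun ν (_ : ν ∈ Finset.univ) => hpt y hy μ ν
  refine hsum.trans ?_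
  simp only [Finset.sum_add_distrib, ← Finset.mul_sum]
  have hφ : ∑ y ∈ box z (R - 1), ∑ μ : Fin d, ∑ ν : Fin d, (if μ ≠ ν then ‖φ (y + unitVec μ + unitVec ν)‖ ^ 2 else (0 : ℝ))
      ≤ d ^ 2 * ∑ w ∈ box z R, ‖φ w‖ ^ 2 := by
    rw [Finset.sum_comm]
    calc ∑ μ : Fin d, ∑ y ∈ box z (R - 1), ∑ ν : Fin d, (if μ ≠ ν then ‖φ (y + unitVec μ + unitVec ν)‖ ^ 2 else (0 : ℝ))
        = ∑ μ : Fin d, ∑ ν : Fin d, ∑ y ∈ box z (R - 1), (if μ ≠ ν then ‖φ (y + unitVec μ + unitVec ν)‖ ^ 2 else (0 : ℝ)) :=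
          Finset.sum_congr rfl fun μ _ => Finset.sum_comm
      _ ≤ ∑ _μ : Fin d, ∑ _ν : Fin d, ∑ w ∈ box z R, ‖φ w‖ ^ 2 :=
          Finset.sum_le_sum fun μ _ => Finset.sum_le_sum fun ν _ => hshift μ ν
      _ = d ^ 2 * ∑ w ∈ box z R, ‖φ w‖ ^ 2 := by
          rw [Finset.sum_const, Finset.sum_const, Finset.card_univ, Fintype.card_fin, smul_smul, nsmul_eq_mul]; push_cast; ring
  have hα2 : 0 ≤ 8 * α ^ 2 := by positivity
  nlinarith [mul_le_mul_of_nonneg_left hφ hα2]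

/-! ## §3 Scalar helpers for the member reading -/

/-- `Σ_μ Σ_ν f μ ν = 2·Σ_{μ<ν} f μ ν` for a symmetric `f` vanishing on the diagonal (pairs ↔ plaquettes). [folklore] -/
theorem sum_sum_eq_two_mul_sum_lt (f : Fin d → Fin d → ℝ) (hdiag : ∀ μ, f μ μ = 0) (hsymm : ∀ μ ν, f μ ν = f ν μ) :
    ∑ μ, ∑ ν, f μ ν = 2 * ∑ μ, ∑ ν, (if μ < ν then f μ ν else 0) := by
  have hsplit : ∀ μ ν, f μ ν = (if μ < ν then f μ ν else 0) + (if ν < μ then f ν μ else 0) := by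
    intro μ ν
    rcases lt_trichotomy μ ν with h | h | h
    · rw [if_pos h, if_neg (not_lt.mpr h.le), add_zero]
    · subst h; rw [if_neg (lt_irrefl _), add_zero, hdiag]
    · rw [if_neg (not_lt.mpr h.le), if_pos h, zero_add, hsymm]
  calc ∑ μ, ∑ ν, f μ ν = ∑ μ, ∑ ν, ((if μ < ν then f μ ν else 0) + (if ν < μ then f ν μ else 0)) :=
        Finset.sum_congr rfl fun μ _ => Finset.sum_congr rfl fun ν _ => hsplit μ ν
    _ = ∑ μ, ∑ ν, (if μ < ν then f μ ν else 0) + ∑ μ, ∑ ν, (if ν < μ then f ν μ else 0) := by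
        simp only [Finset.sum_add_distrib]
    _ = ∑ μ, ∑ ν, (if μ < ν then f μ ν else 0) + ∑ ν, ∑ μ, (if ν < μ then f ν μ else 0) := by
        congr 1; exact Finset.sum_comm
    _ = 2 * ∑ μ, ∑ ν, (if μ < ν then f μ ν else 0) := by rw [two_mul]

/-- `Σ_jk ‖(t•M) j k‖² = t²·Σ_jk ‖M j k‖²` for a real scalar (Frobenius letters). [folklore] -/
theorem frob_real_smul (t : ℝ) (M : Matrix (Fin N) (Fin N) ℂ) :
    ∑ j, ∑ k, ‖(t • M) j k‖ ^ 2 = t ^ 2 * ∑ j, ∑ k, ‖M j k‖ ^ 2 := by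
  rw [Finset.mul_sum]
  refine Finset.sum_congr rfl fun j _ => ?_
  rw [Finset.mul_sum]
  refine Finset.sum_congr rfl fun k _ => ?_
  rw [Matrix.smul_apply, norm_smul, mul_pow, Real.norm_eq_abs, sq_abs]

end Zd

/-- The real bookkeeping of `cutoffH1_member`: collecting the four channels with `ηℓ = 1`. [folklore] -/
theorem h10_arith {c₀ ℓ η d δ α S₁ S₂ A₁ A₂ CG DG G₀ CYI PZ CuS KS nφ nr : ℝ}
    (hc : 0 ≤ c₀) (hd : 0 ≤ d) (hηℓ : η * ℓ = 1)
    (hS1 : S₁ ≤ 2 * A₁) (hS2 : S₂ ≤ 2 * A₂) (hA : A₁ + A₂ ≤ 3 * CG + 2 * DG + 8 * d * δ ^ 2 * G₀)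
    (hB : CG ≤ 2 * CYI + 8 * α ^ 2 * d ^ 2 * PZ) (hCY : CYI ≤ 2 * CuS) (hDG : DG ≤ η ^ 2 * KS)
    (hG : c₀ * G₀ ≤ nr) (hPZ : c₀ * PZ ≤ ℓ ^ 2 * nφ) :
    c₀ * ℓ ^ 2 * S₁ + c₀ * ℓ ^ 2 * S₂
      ≤ 24 * (c₀ * ℓ ^ 2 * CuS) + 48 * d ^ 2 * ℓ ^ 4 * α ^ 2 * nφ + 4 * (c₀ * KS) + 16 * d * ℓ ^ 2 * δ ^ 2 * nr := by
  have hcl : 0 ≤ c₀ * ℓ ^ 2 := by positivity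
  have hηℓ2 : η ^ 2 * ℓ ^ 2 = 1 := by rw [← mul_pow, hηℓ, one_pow]
  have h1 : c₀ * ℓ ^ 2 * (S₁ + S₂) ≤ c₀ * ℓ ^ 2 * (2 * (3 * (2 * (2 * CuS) + 8 * α ^ 2 * d ^ 2 * PZ) + 2 * (η ^ 2 * KS) + 8 * d * δ ^ 2 * G₀)) :=
    mul_le_mul_of_nonneg_left (by nlinarith [sq_nonneg δ, sq_nonneg α]) hcl
  have h2 : 48 * d ^ 2 * ℓ ^ 2 * α ^ 2 * (c₀ * PZ) ≤ 48 * d ^ 2 * ℓ ^ 2 * α ^ 2 * (ℓ ^ 2 * nφ) :=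
    mul_le_mul_of_nonneg_left hPZ (by positivity)
  have h3 : 16 * d * ℓ ^ 2 * δ ^ 2 * (c₀ * G₀) ≤ 16 * d * ℓ ^ 2 * δ ^ 2 * nr :=
    mul_le_mul_of_nonneg_left hG (by positivity)
  have h4 : c₀ * ℓ ^ 2 * (η ^ 2 * KS) = c₀ * KS := by linear_combination (c₀ * KS) * hηℓ2
  nlinarith [h1, h2, h3, h4]


end Summit.QuantumFields.YangMills.Theorems.Prop7LatticeCutoffOneFormSupp

end
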